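import Summits.Ventures.HodgeRepro2.T7SupportDenseRegularPoint

/-!
# The regular non-vanishing locus of a product of factors (support, seat p1)

The global reading of `T7SupportDenseRegularPoint.exists_mem_dense_ne_zero_notMem` takes `G` = a PRODUCT of
archimedean factors, `F` = the product of the factors' bi-periods and `Z` = «non-regular at some factor». This
file supplies the three set-theoretic facts that reading needs, for a product of two factors (iterate for more):

* a product function `(x, y) ↦ f x · g y` of continuous factors is continuous (`continuous_mul_fst_snd`) and is
  non-zero somewhere iff each factor is (`exists_mul_fst_snd_ne_zero_iff`);
* the locus `Z₁ ×ˢ univ ∪ univ ×ˢ Z₂` («non-regular at the first or at the second factor») is closed when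
  `Z₁`, `Z₂` are (`isClosed_prodUnion`) and has empty interior when `Z₁`, `Z₂` have
  (`interior_prodUnion_eq_empty`: `interior_prod_eq` and a finite union of closed sets with empty interior);
* hence every dense `S ⊆ G₁ × G₂` contains `s` with `f s.1 ≠ 0`, `g s.2 ≠ 0`, `s.1 ∉ Z₁`, `s.2 ∉ Z₂`
  (`exists_mem_dense_prod_ne_zero_notMem`).

The density of the diagonal image of the rational points in the product of the archimedean factors (weak
approximation) is a PRINTED input stated in words by the line; nothing here is about any group or any period.
Blind lane: Mathlib + the HodgeRepro2 prefix only; no sorry; axioms ⊆ {propext, Classical.choice, Quot.sound}.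
-/

namespace Summit.Ventures.HodgeRepro2.T7SupportDenseRegularProduct

open Filter Topology Set
open T7SupportDenseRegularPoint

variable {G₁ G₂ : Type*} [TopologicalSpace G₁] [TopologicalSpace G₂]

/-! ### Product functions -/

/-- a product of continuous factors is continuous on the product -/
theorem continuous_mul_fst_snd {f : G₁ → ℂ} {g : G₂ → ℂ} (hf : Continuous f) (hg : Continuous g) :
    Continuous fun p : G₁ × G₂ => f p.1 * g p.2 :=
  (hf.comp continuous_fst).mul (hg.comp continuous_snd)

omit [TopologicalSpace G₁] [TopologicalSpace G₂] in
/-- **a product function is non-zero somewhere iff each factor is** -/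
theorem exists_mul_fst_snd_ne_zero_iff {f : G₁ → ℂ} {g : G₂ → ℂ} :
    (∃ p : G₁ × G₂, f p.1 * g p.2 ≠ 0) ↔ (∃ x, f x ≠ 0) ∧ (∃ y, g y ≠ 0) := by
  constructor
  · rintro ⟨p, hp⟩
    exact ⟨⟨p.1, left_ne_zero_of_mul hp⟩, ⟨p.2, right_ne_zero_of_mul hp⟩⟩
  · rintro ⟨⟨x, hx⟩, ⟨y, hy⟩⟩
    exact ⟨(x, y), mul_ne_zero hx hy⟩

/-! ### The non-regular locus of a product -/

/-- «non-regular at the first or at the second factor» -/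
def prodUnion (Z₁ : Set G₁) (Z₂ : Set G₂) : Set (G₁ × G₂) :=
  Z₁ ×ˢ (univ : Set G₂) ∪ (univ : Set G₁) ×ˢ Z₂

omit [TopologicalSpace G₁] [TopologicalSpace G₂] in
/-- membership in `prodUnion` -/
theorem mem_prodUnion_iff {Z₁ : Set G₁} {Z₂ : Set G₂} {p : G₁ × G₂} :
    p ∈ prodUnion Z₁ Z₂ ↔ p.1 ∈ Z₁ ∨ p.2 ∈ Z₂ := by
  simp [prodUnion]

/-- the locus is closed when both factors' loci are -/
theorem isClosed_prodUnion {Z₁ : Set G₁} {Z₂ : Set G₂} (h₁ : IsClosed Z₁) (h₂ : IsClosed Z₂) :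
    IsClosed (prodUnion Z₁ Z₂) :=
  (h₁.prod isClosed_univ).union (isClosed_univ.prod h₂)

/-- `interior (Z₁ ×ˢ univ) = ∅` when `interior Z₁ = ∅` -/
theorem interior_prod_univ_eq_empty {Z₁ : Set G₁} (h : interior Z₁ = ∅) :
    interior (Z₁ ×ˢ (univ : Set G₂)) = ∅ := by
  rw [interior_prod_eq, h, empty_prod]

/-- `interior (univ ×ˢ Z₂) = ∅` when `interior Z₂ = ∅` -/
theorem interior_univ_prod_eq_empty {Z₂ : Set G₂} (h : interior Z₂ = ∅) :
    interior ((univ : Set G₁) ×ˢ Z₂) = ∅ := by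
  rw [interior_prod_eq, h, prod_empty]

/-- **a union of two closed sets with empty interior has empty interior** -/
theorem interior_union_eq_empty {G : Type*} [TopologicalSpace G] {Z₁ Z₂ : Set G} (h₁c : IsClosed Z₁)
    (h₁ : interior Z₁ = ∅) (h₂ : interior Z₂ = ∅) : interior (Z₁ ∪ Z₂) = ∅ := by
  rw [interior_union_isClosed_of_interior_empty h₁c h₂, h₁]

/-- **the non-regular locus of a product has empty interior** when each factor's has -/
theorem interior_prodUnion_eq_empty {Z₁ : Set G₁} {Z₂ : Set G₂} (h₁c : IsClosed Z₁) (h₁ : interior Z₁ = ∅)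
    (h₂ : interior Z₂ = ∅) : interior (prodUnion Z₁ Z₂) = ∅ :=
  interior_union_eq_empty (h₁c.prod isClosed_univ) (interior_prod_univ_eq_empty h₁)
    (interior_univ_prod_eq_empty h₂)

/-! ### The assembled statement -/

/-- **every dense subset of a product contains a point regular at both factors where both factors are
non-zero**: `f`, `g` continuous and not identically zero, `Z₁`, `Z₂` closed with empty interior. -/
theorem exists_mem_dense_prod_ne_zero_notMem {S : Set (G₁ × G₂)} (hS : Dense S) {f : G₁ → ℂ} {g : G₂ → ℂ}
    (hf : Continuous f) (hg : Continuous g) (hfne : ∃ x, f x ≠ 0) (hgne : ∃ y, g y ≠ 0) {Z₁ : Set G₁}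
    {Z₂ : Set G₂} (h₁c : IsClosed Z₁) (h₁ : interior Z₁ = ∅) (h₂c : IsClosed Z₂) (h₂ : interior Z₂ = ∅) :
    ∃ s ∈ S, f s.1 ≠ 0 ∧ g s.2 ≠ 0 ∧ s.1 ∉ Z₁ ∧ s.2 ∉ Z₂ := by
  obtain ⟨s, hsS, hs, hsZ⟩ := exists_mem_dense_ne_zero_notMem hS (continuous_mul_fst_snd hf hg)
    (exists_mul_fst_snd_ne_zero_iff.2 ⟨hfne, hgne⟩) (isClosed_prodUnion h₁c h₂c)
    (interior_prodUnion_eq_empty h₁c h₁ h₂)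
  rw [mem_prodUnion_iff, not_or] at hsZ
  exact ⟨s, hsS, left_ne_zero_of_mul hs, right_ne_zero_of_mul hs, hsZ.1, hsZ.2⟩

/-- the same for three factors (`G₁ × G₂ × G₃`), by iterating -/
theorem exists_mem_dense_prod₃_ne_zero_notMem {G₃ : Type*} [TopologicalSpace G₃] {S : Set (G₁ × G₂ × G₃)}
    (hS : Dense S) {f : G₁ → ℂ} {g : G₂ → ℂ} {k : G₃ → ℂ} (hf : Continuous f) (hg : Continuous g)
    (hk : Continuous k) (hfne : ∃ x, f x ≠ 0) (hgne : ∃ y, g y ≠ 0) (hkne : ∃ z, k z ≠ 0) {Z₁ : Set G₁}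
    {Z₂ : Set G₂} {Z₃ : Set G₃} (h₁c : IsClosed Z₁) (h₁ : interior Z₁ = ∅) (h₂c : IsClosed Z₂)
    (h₂ : interior Z₂ = ∅) (h₃c : IsClosed Z₃) (h₃ : interior Z₃ = ∅) :
    ∃ s ∈ S, f s.1 ≠ 0 ∧ g s.2.1 ≠ 0 ∧ k s.2.2 ≠ 0 ∧ s.1 ∉ Z₁ ∧ s.2.1 ∉ Z₂ ∧ s.2.2 ∉ Z₃ := by
  obtain ⟨s, hsS, hs1, hs2, hsZ1, hsZ2⟩ := exists_mem_dense_prod_ne_zero_notMem hS hf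
    (continuous_mul_fst_snd hg hk) hfne (exists_mul_fst_snd_ne_zero_iff.2 ⟨hgne, hkne⟩) h₁c h₁
    (isClosed_prodUnion h₂c h₃c) (interior_prodUnion_eq_empty h₂c h₂ h₃)
  rw [mem_prodUnion_iff, not_or] at hsZ2
  exact ⟨s, hsS, hs1, left_ne_zero_of_mul hs2, right_ne_zero_of_mul hs2, hsZ1, hsZ2.1, hsZ2.2⟩

end Summit.Ventures.HodgeRepro2.T7SupportDenseRegularProduct
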